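import Literature.MathematicalPhysics.QuantumLattice.GrassmannGaussianPfaffian
import Literature.MathematicalPhysics.QuantumLattice.CPeriodicBoundaryConditions
import Literature.LinearAlgebra.Matrix.PfaffianDeterminant
import HarnessLib

/-!
# The C⋆-periodic fermionic integral is the Pfaffian `Pf_K(C D_𝒥)`

Trunk **QLatticeAQFT**; sequel of `GrassmannGaussianPfaffian.lean` (the one-species Gaussian
Berezin integral `∫ dθ exp(Σ_{i<j} Aᵢⱼθᵢθⱼ) = Pf A`, Wegner 2016 (5.4) / Zinn-Justin 2021 (1.77)) and
of `CPeriodicBoundaryConditions.lean`, which DEFINES the fermionic weight of one Wilson flavour with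
C⋆ (C-periodic) boundary conditions as a Berezin integral,
`cstarFermionPfaffian S ρ U m r = berezin (grassmannExp (pairingQuadratic (½ • M)))`,
`M = (C ⊗ 1) D_𝒥` the charge-conjugation matrix times the C-periodic Wilson–Dirac operator in the
doublet variables `η` (Lucini–Patella–Ramos–Tantalo 2016, App. D: "`∫_{K b.c.s} 𝒟η e^{½ ηᵀ C D_𝒥 η}
= Pf_K C D_𝒥`, where … `C D_𝒥` is an antisymmetric complex matrix"), recording in its docstrings
that this "integrates to the Pfaffian … up to the orientation sign (Berezin)" without proof.

Here both printed clauses become theorems, with NO orientation sign (the tree's `berezin` and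
`Literature.LinearAlgebra.Matrix.pfaffian` conventions agree, see `GrassmannGaussianPfaffian.lean`):

* `pairingQuadratic_eq_pairForm`, `berezin_grassmannExp_pairingQuadratic` —
  `berezin (exp (Σᵢⱼ Bᵢⱼ θᵢθⱼ)) = pfaffian (B - Bᵀ)` for every `B : Matrix (Fin n) (Fin n) R`, and
  `= pfaffian A` for `B = c • A`, `Aᵀ = -A`, `c + c = 1`
  (`berezin_grassmannExp_pairingQuadratic_smul_of_transpose_eq_neg`);
* `transpose_spinChargeConj_mul_cstarWilsonDirac` — **`C D_𝒥` is antisymmetric** for every unitary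
  colour representation `ρ` (from `Cᵀ = -C`, `(Cγ_μ)ᵀ = Cγ_μ`, `𝒥(V†) = 𝒥(V)ᵀ` and `Kᵀ = K`,
  hop by hop);
* `cstarFermionPfaffian_eq_pfaffian` — in general the C⋆ fermionic integral equals
  `pfaffian (½ • (M - Mᵀ))` for the doublet matrix `M` re-indexed along the tree's enumeration
  `cstarIdxEquiv`; `cstarFermionPfaffian_eq_pfaffian_of_transpose_eq_neg` (`= pfaffian M` when
  `Mᵀ = -M`) and **`cstarFermionPfaffian_eq_pfaffian_of_unitary`**: for unitary `ρ`,
  `∫ 𝒟η e^{½ ηᵀ C D_𝒥 η} = Pf(C D_𝒥)` — Lucini et al.'s equation, as printed;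
* `cstarFermionPfaffian_sq_eq_det_of_unitary` — `(Pf_K C D_𝒥)² = Det_K D_𝒥` (ibid.): Cayley's
  theorem `Literature.LinearAlgebra.Matrix.det_eq_pfaffian_sq` for the antisymmetric `C D_𝒥` and
  `det (1 ⊗ 1 ⊗ C) = 1` (`det γ_μ = 1`).

## Sources

B. Lucini, A. Patella, A. Ramos, N. Tantalo, *Charged hadrons in local finite-volume QED+QCD with C⋆
boundary conditions*, JHEP 02 (2016) 076, arXiv:1509.01636, App. D "Anatomy of the sign problem"
[corpus:paper-arxiv-1509.01636 p0031]: "`S_F = ψ̄ D[V] ψ = −½ ηᵀ C D[𝒥(V)] η` … `𝒥(V) = 1₂ ⊗ Re V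
+ J ⊗ Im V` … defines a representation of the gauge group, unitarily equivalent to the
representation defined by `V`. Integration of the fermionic action … yields
`∫_{K b.c.s} 𝒟η e^{½ ηᵀ C D_𝒥 η} = Pf_K C D_𝒥`, where … `C D_𝒥` is an antisymmetric complex
matrix"; bib key `LuciniEtAl2016`.
F. Wegner, LNP 920 (2016) §5.1 (5.4); J. Zinn-Justin (2021) §1.9 (1.77): the Gaussian Berezin
integral in one species is the Pfaffian; bib keys `Wegner2016`, `ZinnJustin2021`.

## Sequel (was "Not here")

The reality and the sign of `Pf_K(C D_𝒥)` by `γ₅`-hermiticity (Lucini et al. App. D, second half: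
"the Pfaffian itself is real … clearly the Pfaffian is negative only if the Dirac operator `D_𝒥`
has some negative eigenvalues") are PROVED in the sequel `CPeriodicPfaffianSign.lean`
(`conjTranspose_cstarWilsonDirac`, `even_rootMultiplicity_charpoly_cstarWilsonDirac`,
`cstarFermionPfaffian_im_eq_zero`, `cstarFermionPfaffian_eq_prod_eigenvalues`,
`cstarFermionPfaffian_sign_of_no_negative_eigenvalue`), on top of
`Literature/LinearAlgebra/Matrix/PfaffianCharpoly.lean` (`χ_D · det B = [Pf(BD − XB)]²`, even
multiplicities) and `Literature/MathematicalPhysics/QuantumFieldTheory/GammaHermiticityPfaffian.lean`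
(the abstract Γ-Hermitian statement).
-/

noncomputable section

namespace Literature.MathematicalPhysics.QuantumLattice

open scoped Matrix Kronecker
open GrassmannAlgebra Literature.LinearAlgebra.Matrix

section PairingQuadratic

variable (R : Type*) [CommRing R]

/-- The tree's symmetric-free pairing form `Σᵢⱼ Bᵢⱼ θᵢθⱼ` (`pairingQuadratic`) is the pairing form
`Σ_{i<j} (Bᵢⱼ - Bⱼᵢ) θᵢθⱼ` of the antisymmetrised matrix: "only the antisymmetric part of `B`
contributes" (Zinn-Justin 2021, §1.9 after (1.73)). [cite: ZinnJustin2021, §1.9 (1.73)–(1.74)] -/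
theorem pairingQuadratic_eq_pairForm {ι : Type*} [LinearOrder ι] [Fintype ι] (B : Matrix ι ι R) :
    pairingQuadratic B = pairForm R (B - Bᵀ) Finset.univ :=
  sum_sum_smul_gen_mul_gen R B Finset.univ

variable [Algebra ℚ R]

/-- **`∫ dθ exp(Σᵢⱼ Bᵢⱼ θᵢθⱼ) = Pf(B - Bᵀ)`** for the tree's `pairingQuadratic` on `Fin n`
(Zinn-Justin 2021, (1.73)–(1.77) with `a = B - Bᵀ`; Wegner 2016, (5.4)).
[cite: ZinnJustin2021, §1.9 (1.73)–(1.77)] -/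
theorem berezin_grassmannExp_pairingQuadratic {n : ℕ} (B : Matrix (Fin n) (Fin n) R) :
    GrassmannAlgebra.berezin R (Fin n) (grassmannExp (pairingQuadratic B)) = pfaffian (B - Bᵀ) :=
  berezin_grassmannExp_sum_sum R B

/-- **`∫ dθ exp(Σᵢⱼ (c Aᵢⱼ) θᵢθⱼ) = Pf A`** for antisymmetric `A` and `c + c = 1` (the ring's `½`):
the printed one-species Gaussian formula `∫ dθ e^{½ θᵀAθ} = Pf A` (Zinn-Justin 2021, (1.77); Wegner
2016, (5.4)) for the tree's `pairingQuadratic`. [cite: ZinnJustin2021, §1.9 (1.77)] -/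
theorem berezin_grassmannExp_pairingQuadratic_smul_of_transpose_eq_neg {n : ℕ}
    (A : Matrix (Fin n) (Fin n) R) (hA : Aᵀ = -A) {c : R} (hc : c + c = 1) :
    GrassmannAlgebra.berezin R (Fin n) (grassmannExp (pairingQuadratic (c • A))) = pfaffian A :=
  berezin_grassmannExp_sum_sum_smul_of_transpose_eq_neg R A hA hc

end PairingQuadratic

/-! ### `C D_𝒥` is antisymmetric (Lucini et al. 2016, App. D) -/

section CStar

open QuantumFieldTheory

/-- `(C γ_μ)ᵀ = C γ_μ`: together with `Cᵀ = -C` (the tree's `chargeConj_transpose`) this is the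
transpose content of `C⁻¹ γ_μ C = -γ_μᵀ`. [cite: LuciniEtAl2016, §2 (the charge conjugation matrix)] -/
theorem transpose_chargeConj_mul_euclideanGamma (μ : Fin 4) :
    (chargeConj * euclideanGamma μ)ᵀ = chargeConj * euclideanGamma μ := by
  fin_cases μ <;>
  · ext i j
    fin_cases i <;> fin_cases j <;>
      simp [chargeConj, euclideanGamma, QuantumLattice.spinHalfPauli, Matrix.kroneckerMap_apply,
        finProdFinEquiv, Fin.divNat, Fin.modNat, Matrix.mul_apply, Fin.sum_univ_four]

/-- The real form transposes conjugate transposes: `𝒥(V†) = 𝒥(V)ᵀ` (`Jᵀ = -J`), whence `𝒥` of a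
unitary is orthogonal — "`𝒥(V)` defines a representation of the gauge group, unitarily equivalent
to the representation defined by `V`". [cite: LuciniEtAl2016, App. D (real form 𝒥(V))] -/
theorem realify_conjTranspose {n : Type*} (V : Matrix n n ℂ) : realify Vᴴ = (realify V)ᵀ := by
  ext ⟨a, i⟩ ⟨b, j⟩
  fin_cases a <;> fin_cases b <;>
    simp [realify, realJ, Matrix.kroneckerMap_apply, Matrix.conjTranspose_apply]

/-- `Kᵀ = K` (`K = diag(1, -1)`). [folklore] -/
private theorem kFlip_transpose : kFlipᵀ = kFlip := by
  ext i j; fin_cases i <;> fin_cases j <;> simp [kFlip]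

variable {L N : ℕ} {G : Type*} [Group G] (S : Finset (Fin 4)) (ρ : G →* Matrix (Fin N) (Fin N) ℂ)

/-- The boundary flip on a hop is symmetric: `(kAt x μ)ᵀ = kAt x μ`. [folklore] -/
private theorem kAt_transpose (x : Site 4 L) (μ : Fin 4) :
    (kAt (N := N) S x μ)ᵀ = kAt (N := N) S x μ := by
  unfold kAt
  split_ifs
  · rw [← Matrix.kroneckerMap_transpose, kFlip_transpose, Matrix.transpose_one]
  · rw [Matrix.transpose_one]

/-- For a unitary matrix representation, `ρ(g⁻¹) = ρ(g)†`. [folklore] -/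
private theorem map_inv_eq_conjTranspose (hρ : ∀ g, (ρ g)ᴴ * ρ g = 1) (g : G) :
    ρ g⁻¹ = (ρ g)ᴴ := by
  have h1 : ρ g⁻¹ * ρ g = 1 := by rw [← map_mul, inv_mul_cancel, map_one]
  rw [← Matrix.inv_eq_left_inv h1, Matrix.inv_eq_left_inv (hρ g)]

variable [NeZero L]

/-- Entry formula for `(1 ⊗ 1 ⊗ C) · X`: only the spin index is summed. [folklore] -/
private theorem spinChargeConj_mul_apply
    (X : Matrix (Site 4 L × (Fin 2 × Fin N) × Fin 4) (Site 4 L × (Fin 2 × Fin N) × Fin 4) ℂ)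
    (p q : Site 4 L × (Fin 2 × Fin N) × Fin 4) :
    (spinChargeConj (L := L) (N := N) * X) p q = ∑ t, chargeConj p.2.2 t * X (p.1, (p.2.1, t)) q := by
  rw [Matrix.mul_apply, Fintype.sum_prod_type, Finset.sum_eq_single p.1, Fintype.sum_prod_type,
    Finset.sum_eq_single p.2.1]
  · simp [spinChargeConj, Matrix.kroneckerMap_apply]
  · intro c _ hc
    simp [spinChargeConj, Matrix.kroneckerMap_apply, Matrix.one_apply_ne' hc]
  · simp
  · intro x _ hx
    simp [spinChargeConj, Matrix.kroneckerMap_apply, Matrix.one_apply_ne' hx]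
  · simp

/-- `(1 ⊗ 1 ⊗ C)ᵀ = -(1 ⊗ 1 ⊗ C)` on the doublet quark variables (`Cᵀ = -C`).
[cite: LuciniEtAl2016, §2 (the charge conjugation matrix)] -/
theorem spinChargeConj_transpose :
    (spinChargeConj : Matrix (Site 4 L × (Fin 2 × Fin N) × Fin 4) _ ℂ)ᵀ = -spinChargeConj := by
  rw [spinChargeConj, ← Matrix.kroneckerMap_transpose, ← Matrix.kroneckerMap_transpose,
    Matrix.transpose_one, Matrix.transpose_one, chargeConj_transpose, ← neg_one_smul ℂ chargeConj,
    Matrix.kronecker_smul, Matrix.kronecker_smul, neg_one_smul]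

variable (U : GaugeConfig 4 L G) (m r : ℝ)

/-- The `4 × 4` spin block of `D_𝒥` between the (site, doublet ⊗ colour) indices `(x, c)` and
`(y, d)`: mass term, forward hops `(r - γ_μ) ⊗ 𝒥(U)K`, backward hops `(r + γ_μ) ⊗ K𝒥(U⁻¹)`.
[cite: LuciniEtAl2016, App. D (K boundary conditions; S_F = −½ηᵀCD_𝒥η)] -/
private def cstarSpinBlock (x : Site 4 L) (c : Fin 2 × Fin N) (y : Site 4 L) (d : Fin 2 × Fin N) :
    Matrix (Fin 4) (Fin 4) ℂ :=
  (if x = y ∧ c = d then ((m + 4 * r : ℝ) : ℂ) else 0) • (1 : Matrix (Fin 4) (Fin 4) ℂ) -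
    (1 / 2 : ℂ) • ∑ μ : Fin 4,
      ((if y = QuantumFieldTheory.Site.shift x μ then
          (realify (ρ (U (x, μ))) * kAt (N := N) S x μ) c d else 0) •
          ((r : ℂ) • (1 : Matrix (Fin 4) (Fin 4) ℂ) - euclideanGamma μ) +
        (if x = QuantumFieldTheory.Site.shift y μ then
          (kAt (N := N) S y μ * realify (ρ ((U (y, μ))⁻¹))) c d else 0) •
          ((r : ℂ) • (1 : Matrix (Fin 4) (Fin 4) ℂ) + euclideanGamma μ))

omit [NeZero L] in
/-- Entries of `D_𝒥` through the spin blocks. [folklore] -/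
private theorem cstarWilsonDirac_apply (x : Site 4 L) (c : Fin 2 × Fin N) (s : Fin 4) (y : Site 4 L)
    (d : Fin 2 × Fin N) (s' : Fin 4) :
    cstarWilsonDirac S ρ U m r (x, (c, s)) (y, (d, s')) = cstarSpinBlock S ρ U m r x c y d s s' := by
  simp only [cstarWilsonDirac, cstarSpinBlock, Matrix.of_apply, Matrix.sub_apply, Matrix.smul_apply,
    Matrix.sum_apply, Matrix.add_apply, smul_eq_mul, Prod.mk.injEq]
  congr 1
  · by_cases h : x = y ∧ c = d
    · obtain ⟨rfl, rfl⟩ := h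
      by_cases hs : s = s'
      · subst hs; simp
      · simp [hs, Matrix.one_apply_ne hs]
    · rw [if_neg (fun h' => h ⟨h'.1, h'.2.1⟩), if_neg h, zero_mul]
  · congr 1
    refine Finset.sum_congr rfl fun μ _ => ?_
    congr 1
    · split_ifs <;> simp [mul_comm]
    · split_ifs <;> simp [mul_comm]

/-- Entries of `(C ⊗ 1) · D_𝒥`: `C` times the spin block. [folklore] -/
private theorem spinChargeConj_mul_cstarWilsonDirac_apply (x : Site 4 L) (c : Fin 2 × Fin N)
    (s : Fin 4) (y : Site 4 L) (d : Fin 2 × Fin N) (s' : Fin 4) :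
    (spinChargeConj (L := L) (N := N) * cstarWilsonDirac S ρ U m r) (x, (c, s)) (y, (d, s')) =
      (chargeConj * cstarSpinBlock S ρ U m r x c y d) s s' := by
  rw [spinChargeConj_mul_apply, Matrix.mul_apply]
  refine Finset.sum_congr rfl fun t _ => ?_
  rw [cstarWilsonDirac_apply]

omit [NeZero L] in
/-- The block identity behind antisymmetry: `(C B_{(x,c),(y,d)})ᵀ = -C B_{(y,d),(x,c)}` — the mass
term by `Cᵀ = -C`, the hops because a forward hop read backwards is a backward hop:
`(C(r - γ_μ))ᵀ = -C(r + γ_μ)` and `(𝒥(U)K)ᵀ = K𝒥(U)ᵀ = K𝒥(U†) = K𝒥(U⁻¹)` for unitary `ρ`.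
[folklore] -/
private theorem transpose_chargeConj_mul_cstarSpinBlock (hρ : ∀ g, (ρ g)ᴴ * ρ g = 1)
    (x : Site 4 L) (c : Fin 2 × Fin N) (y : Site 4 L) (d : Fin 2 × Fin N) :
    (chargeConj * cstarSpinBlock S ρ U m r x c y d)ᵀ =
      -(chargeConj * cstarSpinBlock S ρ U m r y d x c) := by
  have hR : ∀ z μ, realify (ρ ((U (z, μ))⁻¹)) = (realify (ρ (U (z, μ))))ᵀ := fun z μ => by
    rw [map_inv_eq_conjTranspose ρ hρ, realify_conjTranspose]
  have hW : ∀ z μ (a b : Fin 2 × Fin N),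
      (kAt (N := N) S z μ * realify (ρ ((U (z, μ))⁻¹))) a b =
        (realify (ρ (U (z, μ))) * kAt (N := N) S z μ) b a := fun z μ a b => by
    rw [hR, ← kAt_transpose S z μ, ← Matrix.transpose_mul, kAt_transpose, Matrix.transpose_apply]
  have hxy : (x = y ∧ c = d) ↔ (y = x ∧ d = c) := by
    constructor <;> rintro ⟨rfl, rfl⟩ <;> exact ⟨rfl, rfl⟩
  -- distribute `C *` over the block
  simp only [cstarSpinBlock, smul_sub, smul_add, Finset.smul_sum, Matrix.mul_sub, Matrix.mul_add,
    Finset.mul_sum, Matrix.mul_smul, Matrix.mul_one, hW, if_congr hxy rfl rfl]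
  -- transpose termwise
  simp only [Matrix.transpose_add, Matrix.transpose_neg, Matrix.transpose_smul,
    Matrix.transpose_sum, chargeConj_transpose, transpose_chargeConj_mul_euclideanGamma, smul_neg,
    Finset.sum_add_distrib, Finset.sum_neg_distrib, neg_add, neg_neg, sub_eq_add_neg]
  abel

/-- **`C D_𝒥` is an antisymmetric matrix** (Lucini et al. 2016, App. D: "`C D_𝒥` is an
antisymmetric complex matrix"), for the tree's doublet operator `(1 ⊗ 1 ⊗ C) · cstarWilsonDirac` and
every unitary colour representation `ρ` (any set `S` of C-directions, any periodic link field `U`,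
real `m`, `r`). [cite: LuciniEtAl2016, App. D (C D_𝒥 antisymmetric)] -/
theorem transpose_spinChargeConj_mul_cstarWilsonDirac (hρ : ∀ g, (ρ g)ᴴ * ρ g = 1) :
    (spinChargeConj (L := L) (N := N) * cstarWilsonDirac S ρ U m r)ᵀ =
      -(spinChargeConj (L := L) (N := N) * cstarWilsonDirac S ρ U m r) := by
  ext ⟨x, c, s⟩ ⟨y, d, s'⟩
  rw [Matrix.transpose_apply, Matrix.neg_apply, spinChargeConj_mul_cstarWilsonDirac_apply,
    spinChargeConj_mul_cstarWilsonDirac_apply, ← Matrix.transpose_apply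
      (chargeConj * cstarSpinBlock S ρ U m r y d x c) s s',
    transpose_chargeConj_mul_cstarSpinBlock S ρ U m r hρ, Matrix.neg_apply]

/-! ### The C⋆ fermionic integral -/

/-- **The C⋆-periodic fermionic integral of one Wilson flavour is a Pfaffian**: with
`M = (C ⊗ 1) · D_𝒥` re-indexed along the tree's enumeration `cstarIdxEquiv` of the doublet quark
variables, `∫ 𝒟η exp(½ ηᵀ M η) = Pf(½ (M − Mᵀ))` — the Pfaffian of the antisymmetric part of `M`
— with no orientation sign; no hypothesis on `ρ`. [cite: LuciniEtAl2016, App. D (S_F = −½ηᵀCD_𝒥η; Pfaffian Pf_K(CD_𝒥))] -/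
theorem cstarFermionPfaffian_eq_pfaffian (U : GaugeConfig 4 L G) (m r : ℝ) :
    cstarFermionPfaffian S ρ U m r =
      pfaffian ((1 / 2 : ℂ) • (Matrix.reindex cstarIdxEquiv cstarIdxEquiv
          (spinChargeConj * cstarWilsonDirac S ρ U m r) -
        (Matrix.reindex cstarIdxEquiv cstarIdxEquiv
          (spinChargeConj * cstarWilsonDirac S ρ U m r))ᵀ)) := by
  rw [cstarFermionPfaffian, cstarFermiBoltzmann, berezin_grassmannExp_pairingQuadratic,
    Matrix.transpose_smul, smul_sub]

/-- If the (re-indexed) doublet matrix `M = (C ⊗ 1) · D_𝒥` is antisymmetric, the C⋆-periodic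
fermionic integral of one Wilson flavour is exactly its Pfaffian, `∫ 𝒟η exp(½ ηᵀ M η) = Pf(M)`
(Lucini et al. 2016, App. D; the Gaussian Berezin integral, Wegner 2016 (5.4)).
[cite: LuciniEtAl2016, App. D (Pfaffian Pf_K(CD_𝒥))] -/
theorem cstarFermionPfaffian_eq_pfaffian_of_transpose_eq_neg (U : GaugeConfig 4 L G) (m r : ℝ)
    (hM : (Matrix.reindex cstarIdxEquiv cstarIdxEquiv
        (spinChargeConj * cstarWilsonDirac S ρ U m r))ᵀ =
      -Matrix.reindex cstarIdxEquiv cstarIdxEquiv (spinChargeConj * cstarWilsonDirac S ρ U m r)) :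
    cstarFermionPfaffian S ρ U m r =
      pfaffian (Matrix.reindex cstarIdxEquiv cstarIdxEquiv
        (spinChargeConj * cstarWilsonDirac S ρ U m r)) := by
  rw [cstarFermionPfaffian, cstarFermiBoltzmann]
  exact berezin_grassmannExp_pairingQuadratic_smul_of_transpose_eq_neg ℂ _ hM (by norm_num)

/-- **`∫_{K b.c.s} 𝒟η e^{½ ηᵀ C D_𝒥 η} = Pf_K(C D_𝒥)`** (Lucini–Patella–Ramos–Tantalo 2016, App. D,
as printed): for a unitary colour representation `ρ` the C⋆-periodic fermionic integral of one Wilson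
flavour equals the Pfaffian of `C D_𝒥` (in the doublet variables, re-indexed along `cstarIdxEquiv`),
with no orientation sign. [cite: LuciniEtAl2016, App. D (∫𝒟η e^{½ηᵀCD_𝒥η} = Pf_K CD_𝒥)] -/
theorem cstarFermionPfaffian_eq_pfaffian_of_unitary (hρ : ∀ g, (ρ g)ᴴ * ρ g = 1)
    (U : GaugeConfig 4 L G) (m r : ℝ) :
    cstarFermionPfaffian S ρ U m r =
      pfaffian (Matrix.reindex cstarIdxEquiv cstarIdxEquiv
        (spinChargeConj * cstarWilsonDirac S ρ U m r)) := by
  refine cstarFermionPfaffian_eq_pfaffian_of_transpose_eq_neg S ρ U m r ?_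
  rw [Matrix.transpose_reindex, transpose_spinChargeConj_mul_cstarWilsonDirac S ρ U m r hρ]
  ext i j
  simp [Matrix.reindex_apply]

end CStar

/-! ### `(Pf_K C D_𝒥)² = Det_K D_𝒥` (Lucini et al. 2016, App. D) -/

section Determinant

open QuantumFieldTheory

/-- `det γ_μ = 1` (each `γ_μ` is a Kronecker product of two Pauli-type `2 × 2` matrices of
determinant `-1` or `1`). [folklore] -/
private theorem det_euclideanGamma (μ : Fin 4) : (euclideanGamma μ).det = 1 := by
  fin_cases μ <;>
    simp [euclideanGamma, QuantumLattice.spinHalfPauli, Matrix.det_kronecker, Matrix.det_fin_two]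

/-- `det C = det γ₁ · det γ₃ = 1`. [folklore] -/
private theorem det_chargeConj : chargeConj.det = 1 := by
  rw [chargeConj, Matrix.det_mul, det_euclideanGamma, det_euclideanGamma, mul_one]

/-- Over `ℂ` an antisymmetric matrix has zero diagonal. [folklore] -/
private theorem apply_self_eq_zero_of_transpose_eq_neg {n : Type*} (M : Matrix n n ℂ)
    (hM : Mᵀ = -M) (i : n) : M i i = 0 := by
  have h := congrFun (congrFun hM i) i
  rw [Matrix.transpose_apply, Matrix.neg_apply] at h
  have h2 : (2 : ℂ) * M i i = 0 := by linear_combination h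
  simpa using h2

variable {L N : ℕ} {G : Type*} [Group G] (S : Finset (Fin 4)) (ρ : G →* Matrix (Fin N) (Fin N) ℂ)
variable [NeZero L]

/-- `det (1 ⊗ 1 ⊗ C) = 1` on the doublet quark variables. [folklore] -/
private theorem det_spinChargeConj :
    (spinChargeConj : Matrix (Site 4 L × (Fin 2 × Fin N) × Fin 4) _ ℂ).det = 1 := by
  rw [spinChargeConj, Matrix.det_kronecker, Matrix.det_kronecker, Matrix.det_one, Matrix.det_one,
    det_chargeConj]
  simp

/-- The re-indexed doublet matrix `M = (C ⊗ 1) D_𝒥` is antisymmetric for unitary `ρ`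
(`transpose_spinChargeConj_mul_cstarWilsonDirac` transported along `cstarIdxEquiv`).
[cite: LuciniEtAl2016, App. D (C D_𝒥 antisymmetric)] -/
theorem transpose_reindex_spinChargeConj_mul_cstarWilsonDirac (hρ : ∀ g, (ρ g)ᴴ * ρ g = 1)
    (U : GaugeConfig 4 L G) (m r : ℝ) :
    (Matrix.reindex cstarIdxEquiv cstarIdxEquiv
        (spinChargeConj * cstarWilsonDirac S ρ U m r))ᵀ =
      -Matrix.reindex cstarIdxEquiv cstarIdxEquiv (spinChargeConj * cstarWilsonDirac S ρ U m r) := by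
  rw [Matrix.transpose_reindex, transpose_spinChargeConj_mul_cstarWilsonDirac S ρ U m r hρ]
  ext i j
  simp [Matrix.reindex_apply]

/-- **`(Pf_K C D_𝒥)² = Det_K C D_𝒥 = Det_K D_𝒥`** (Lucini et al. 2016, App. D, the identity after the
Pfaffian formula): for unitary `ρ` the square of the C⋆-periodic fermionic integral of one Wilson
flavour is the determinant of the C-periodic Wilson–Dirac operator `D_𝒥` — Cayley's theorem
`det = Pf²` (`Literature.LinearAlgebra.Matrix.det_eq_pfaffian_sq`) for the antisymmetric `C D_𝒥`,
and `det (C ⊗ 1) = 1`. [cite: LuciniEtAl2016, App. D ((Pf_K CD_𝒥)² = Det_K D_𝒥)] -/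
theorem cstarFermionPfaffian_sq_eq_det_of_unitary (hρ : ∀ g, (ρ g)ᴴ * ρ g = 1)
    (U : GaugeConfig 4 L G) (m r : ℝ) :
    cstarFermionPfaffian S ρ U m r ^ 2 = (cstarWilsonDirac S ρ U m r).det := by
  have hanti := transpose_reindex_spinChargeConj_mul_cstarWilsonDirac S ρ hρ U m r
  rw [cstarFermionPfaffian_eq_pfaffian_of_unitary S ρ hρ U m r,
    ← det_eq_pfaffian_sq _ hanti (apply_self_eq_zero_of_transpose_eq_neg _ hanti),
    Matrix.det_reindex_self, Matrix.det_mul, det_spinChargeConj, one_mul]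

end Determinant

end Literature.MathematicalPhysics.QuantumLattice
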